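/-
Copyright: internal research formalization. Sources: Y. Filmus, G. Kindler, N. Lifshitz, D. Minzer,
*Hypercontractivity on the symmetric group*, Forum Math. Sigma 12 (2024) e6 = arXiv:2009.05503
[FilmusKindlerLifshitzMinzer2024], §7.4 Thm. 7.16 (proof) and Cor. 7.17 (held text `paper:arxiv-2009.05503`,
chunks p0028–p0029); P. Keevash, N. Lifshitz, *Sharp hypercontractivity for symmetric groups and its
applications*, arXiv:2307.15030 [KeevashLifshitz2023], Thm. 3.1 (p. 17).
-/
import Literature.Combinatorics.Additive.SliceSymmetricGroupCoupling
import HarnessLib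

/-!
# A level-`d` inequality for global functions on a slice, via the coupling with `S_n` — PROVED

Filmus–Kindler–Lifshitz–Minzer, §7.4, after Theorem 7.16, verbatim (Corollary 7.17 and the sentence
before it): *"The coupling given in the proof of Theorem 7.16 also implies in the same way a level-`d`
inequality over `𝒰_{k_1,…,k_m}`, from [the] corresponding result in `S_n`. […] (this proof uses Theorem
7.16 and so relies on an additional easy property of `M`, namely that maps [sic] `d`-juntas to
`d`-juntas.)"* This file carries out that transfer for the two-block slice `([n] choose t)` with, as
the `S_n` input, the tree's PROVED Keevash–Lifshitz Theorem 3.1 in its bounded-`L¹`-global dual form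
(`isL1GlobalSn_dual`, `GlobalLevelInequalityBounded.lean`; unconditional since
`GlobalLevelDInequalityBiglobal_holds`). The constants are therefore Keevash–Lifshitz's, not the ones
printed in Cor. 7.17; the METHOD (lift by `M`, use that `M` preserves `L_p` norms, globalness and
juntas) is Cor. 7.17's.

* `sliceMono I = 1[∀ k, I k ∈ U]`, `sliceDegLE n d` = their span for `≤ d` coordinates (the `d`-juntas
  of the slice generate the same space); **`vec_liftCut_sliceMono`**: `M(1[range I ⊆ U]) = Σ_{J : values in T₀} 1_{U_{I→J}}`,
  hence **`vec_liftCut_mem_degLE`**: `M` maps `sliceDegLE n d` into `V_{≤ d}(S_n)` ("maps `d`-juntas to `d`-juntas").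
* `SliceOrth T₀ e q`: `q` sums to zero on every pattern class `{U : |U| = t, U ∩ R = P}` with `|R| ≤ e`
  (orthogonality to the `e`-juntas of the slice); **`sum_umvirate_liftCut_eq_zero`** /
  **`inner_vec_liftCut_eq_zero`**: then `Mq ⊥ V_{≤ e}(S_n)` — via the fibre-count invariance of the
  coupling under the pointwise stabiliser of `range I` (`exists_perm_fix_map'`, `card_fibre_map`).
* **`slice_levelD_dual`** — for `|h| ≤ G` on the `t`-sets, `(r, γ, d)`-`L¹`-global on the slice
  (`IsL1GlobalSlice`), `r > 1`, `0 < γ < G`, `1 ≤ d ≤ min(⅛ log(G/γ), 10⁻⁵ n)`, and a test function `q` of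
  slice-degree `≤ d` orthogonal to the `(d−1)`-juntas:
  `(Σ_{|U|=t} h(U) q(U))² ≤ C(n,t) · (Σ_{|U|=t} q(U)²) · γ² (5·10⁵ r² d⁻¹ log(G/γ))^d`,
  i.e. `⟨h, q⟩² ≤ ‖q‖₂² · γ² (…)^d` in expectation normalisation — at EVERY slice size `t`, with no
  `(n+1)^{1/r}`-type loss (compare the biased-cube road of `SliceLevelInequality.lean`).

0 facts, 0 sorries. Label: instrument/catalogue for the F-N2 rung (the cut factor of the crux's domain);
nothing about psd rank or P-vs-NP.

## References
* [FilmusKindlerLifshitzMinzer2024] Forum Math. Sigma 12 (2024) e6, doi:10.1017/fms.2023.118 — §7.4 Thm. 7.16 (proof), Cor. 7.17.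
* [KeevashLifshitz2023] arXiv:2307.15030 — Thm. 3.1 (p. 17), Def. 1.7 (degree).
-/

noncomputable section

namespace Literature.Combinatorics.Additive.KeevashLifshitz

open Finset
open scoped InnerProductSpace

variable {n : ℕ}

/-! ## `M` maps slice juntas into `V_{≤ d}(S_n)` -/

/-- The slice monomial `1[I k ∈ U for all k]` (a `|range I|`-junta of the slice).
[cite: FilmusKindlerLifshitzMinzer2024, §7.4 Def. 7.14 ("(A, α) … is a d-restriction if |A| ≤ d")] -/
def sliceMono {s : ℕ} (I : Fin s → Fin n) : Finset (Fin n) → ℝ := fun U => if ∀ k, I k ∈ U then 1 else 0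

/-- `V_{≤ d}` of the slice: the span of the monomials in `≤ d` coordinates (= the span of the `d`-juntas).
[cite: FilmusKindlerLifshitzMinzer2024, §7.4 Cor. 7.17 ("maps d-juntas to d-juntas")] -/
def sliceDegLE (n d : ℕ) : Submodule ℝ (Finset (Fin n) → ℝ) :=
  Submodule.span ℝ {q | ∃ s : ℕ, s ≤ d ∧ ∃ I : Fin s → Fin n, q = sliceMono I}

/-- [cite: FilmusKindlerLifshitzMinzer2024, §7.4 Cor. 7.17] -/
theorem sliceMono_mem_sliceDegLE {s d : ℕ} (hs : s ≤ d) (I : Fin s → Fin n) : sliceMono I ∈ sliceDegLE n d :=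
  Submodule.subset_span ⟨s, hs, I, rfl⟩

/-- `vec` is additive over finite sums. [folklore] -/
private theorem vec_finset_sum {ι : Type*} (s : Finset ι) (F : ι → Equiv.Perm (Fin n) → ℝ) :
    vec (fun σ => ∑ i ∈ s, F i σ) = ∑ i ∈ s, vec (F i) := by
  unfold vec
  rw [← WithLp.toLp_sum]
  congr 1
  funext σ
  simp [Finset.sum_apply]

/-- The lift as a linear map `L²(slice) → L²(S_n)`. [cite: FilmusKindlerLifshitzMinzer2024, §7.4 Thm. 7.16 (proof: "M is linear")] -/
def liftLin (T₀ : Finset (Fin n)) : (Finset (Fin n) → ℝ) →ₗ[ℝ] SnSpace n where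
  toFun h := vec (liftCut T₀ h)
  map_add' f g := by ext σ; simp only [vec_apply, liftCut_apply, Pi.add_apply, PiLp.add_apply]
  map_smul' c f := by ext σ; simp only [vec_apply, liftCut_apply, Pi.smul_apply, PiLp.smul_apply, RingHom.id_apply]

/-- [cite: FilmusKindlerLifshitzMinzer2024, §7.4 Thm. 7.16 (proof)] -/
@[simp] theorem liftLin_apply (T₀ : Finset (Fin n)) (h : Finset (Fin n) → ℝ) : liftLin T₀ h = vec (liftCut T₀ h) := rfl

/-- A permutation respects `T = {(I k, J k)}` iff `J = π ∘ I`. [cite: KeevashLifshitz2023, §1.2 (p. 4)] -/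
theorem mem_umvirate_iff_comp {s : ℕ} {I J : Fin s → Fin n} {π : Equiv.Perm (Fin n)} :
    π ∈ umvirate I J ↔ J = ⇑π ∘ I := by
  rw [mem_umvirate]
  constructor
  · intro h; funext k; exact (h k).symm
  · intro h k; rw [h]; rfl

/-- **`M(1[range I ⊆ U]) = Σ_{J with values in T₀} 1_{U_{I→J}}`**: the lift of a slice monomial in `s`
coordinates is a sum of `s`-umvirate indicators. [cite: FilmusKindlerLifshitzMinzer2024, §7.4 Cor. 7.17 ("M … maps d-juntas to d-juntas")] -/
theorem vec_liftCut_sliceMono (T₀ : Finset (Fin n)) {s : ℕ} (I : Fin s → Fin n) :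
    vec (liftCut T₀ (sliceMono I)) =
      ∑ J ∈ (Finset.univ : Finset (Fin s → Fin n)).filter (fun J => ∀ k, J k ∈ T₀), indVec (umvirate I J) := by
  classical
  have hpt : ∀ π : Equiv.Perm (Fin n), liftCut T₀ (sliceMono I) π =
      ∑ J ∈ (Finset.univ : Finset (Fin s → Fin n)).filter (fun J => ∀ k, J k ∈ T₀),
        (if π ∈ umvirate I J then (1 : ℝ) else 0) := by
    intro π
    rw [liftCut_apply]
    have h1 : ∀ J : Fin s → Fin n, (if π ∈ umvirate I J then (1 : ℝ) else 0) = if J = ⇑π ∘ I then 1 else 0 :=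
      fun J => by
        by_cases hJ : J = ⇑π ∘ I
        · rw [if_pos hJ, if_pos (mem_umvirate_iff_comp.2 hJ)]
        · rw [if_neg hJ, if_neg (fun h => hJ (mem_umvirate_iff_comp.1 h))]
    simp_rw [h1]
    rw [Finset.sum_ite_eq']
    simp only [Finset.mem_filter, Finset.mem_univ, true_and, Function.comp_apply, sliceMono, mem_cutOf]
  calc vec (liftCut T₀ (sliceMono I))
      = vec (fun π => ∑ J ∈ (Finset.univ : Finset (Fin s → Fin n)).filter (fun J => ∀ k, J k ∈ T₀),
          (if π ∈ umvirate I J then (1 : ℝ) else 0)) := by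
        congr 1; funext π; exact hpt π
    _ = _ := by rw [vec_finset_sum]; rfl

/-- **`M` maps `V_{≤ d}(slice)` into `V_{≤ d}(S_n)`.** [cite: FilmusKindlerLifshitzMinzer2024, §7.4 Cor. 7.17] -/
theorem vec_liftCut_mem_degLE (T₀ : Finset (Fin n)) {d : ℕ} {q : Finset (Fin n) → ℝ} (hq : q ∈ sliceDegLE n d) :
    vec (liftCut T₀ q) ∈ degLE n d := by
  rw [← liftLin_apply]
  induction hq using Submodule.span_induction with
  | mem x hx =>
    obtain ⟨s, hs, I, rfl⟩ := hx
    rw [liftLin_apply, vec_liftCut_sliceMono]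
    exact Submodule.sum_mem _ fun J _ => indVec_umvirate_mem_degLE hs I J
  | zero => rw [map_zero]; exact Submodule.zero_mem _
  | add x y _ _ hx hy => rw [map_add]; exact Submodule.add_mem _ hx hy
  | smul a x _ hx => rw [map_smul]; exact Submodule.smul_mem _ a hx

/-! ## `M` maps functions orthogonal to the slice `e`-juntas into `V_{≤ e}(S_n)^⊥` -/

/-- **Orthogonality to the `e`-juntas of the slice**: `q` sums to zero over every pattern class
`{U : |U| = |T₀|, U ∩ R = P}` with `|R| ≤ e`. [cite: FilmusKindlerLifshitzMinzer2024, §7.4 Cor. 7.17] -/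
def SliceOrth (T₀ : Finset (Fin n)) (e : ℕ) (q : Finset (Fin n) → ℝ) : Prop :=
  ∀ R : Finset (Fin n), R.card ≤ e → ∀ P : Finset (Fin n),
    ∑ U ∈ (Finset.univ.powersetCard T₀.card).filter (fun U => U ∩ R = P), q U = 0

/-- Transitivity of the pointwise stabiliser of `R` on the `t`-sets with a fixed trace on `R`.
[cite: FilmusKindlerLifshitzMinzer2024, §7.4 Thm. 7.16 (proof)] -/
theorem exists_perm_fix_map' (R : Finset (Fin n)) {U U' : Finset (Fin n)} (hcard : U.card = U'.card)
    (hinter : U ∩ R = U' ∩ R) :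
    ∃ σ : Equiv.Perm (Fin n), (∀ x ∈ R, σ x = x) ∧ U.map σ.toEmbedding = U' := by
  classical
  have hcd : (U \ R).card = (U' \ R).card := by
    have h1 := Finset.card_sdiff_add_card_inter U R
    have h2 := Finset.card_sdiff_add_card_inter U' R
    rw [hinter, hcard] at h1
    omega
  let e : ↥(U \ R) ≃ ↥(U' \ R) := Finset.equivOfCardEq hcd
  let f : ↥R ⊕ ↥(U \ R) → Fin n := Sum.elim (fun x => x.1) fun x => x.1
  let g : ↥R ⊕ ↥(U \ R) → Fin n := Sum.elim (fun x => x.1) fun x => (e x).1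
  have hf : Function.Injective f := by
    rintro (y | x) (y' | x') h
    · change y.1 = y'.1 at h
      exact congrArg Sum.inl (Subtype.ext h)
    · change y.1 = x'.1 at h
      exact absurd (h ▸ y.2) (Finset.mem_sdiff.1 x'.2).2
    · change x.1 = y'.1 at h
      exact absurd (h.symm ▸ y'.2) (Finset.mem_sdiff.1 x.2).2
    · change x.1 = x'.1 at h
      exact congrArg Sum.inr (Subtype.ext h)
  have hg : Function.Injective g := by
    rintro (y | x) (y' | x') h
    · change y.1 = y'.1 at h
      exact congrArg Sum.inl (Subtype.ext h)
    · change y.1 = (e x').1 at h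
      exact absurd (h ▸ y.2) (Finset.mem_sdiff.1 (e x').2).2
    · change (e x).1 = y'.1 at h
      exact absurd (h.symm ▸ y'.2) (Finset.mem_sdiff.1 (e x).2).2
    · change (e x).1 = (e x').1 at h
      exact congrArg Sum.inr (e.injective (Subtype.ext h))
  obtain ⟨σ, hσ⟩ := Equiv.Perm.exists_extending_pair f g hf hg
  have hσR : ∀ x ∈ R, σ x = x := fun x hx => hσ (Sum.inl ⟨x, hx⟩)
  refine ⟨σ, hσR, ?_⟩
  apply Finset.eq_of_subset_of_card_le
  · intro y hy
    obtain ⟨u, hu, rfl⟩ := Finset.mem_map.1 hy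
    change σ u ∈ U'
    by_cases huR : u ∈ R
    · rw [hσR u huR]
      have : u ∈ U' ∩ R := hinter ▸ Finset.mem_inter.2 ⟨hu, huR⟩
      exact (Finset.mem_inter.1 this).1
    · have hux : u ∈ U \ R := Finset.mem_sdiff.2 ⟨hu, huR⟩
      have hσu : σ u = (e ⟨u, hux⟩).1 := hσ (Sum.inr ⟨u, hux⟩)
      rw [hσu]
      exact (Finset.mem_sdiff.1 (e ⟨u, hux⟩).2).1
  · rw [Finset.card_map, hcard]

/-- **If `q` is orthogonal to the `e`-juntas of the slice then `Σ_{π ∈ U_{I→J}} q(U(π)) = 0` for every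
umvirate with `s ≤ e` index pairs** (arbitrary index data `I, J`).
[cite: FilmusKindlerLifshitzMinzer2024, §7.4 Cor. 7.17] -/
theorem sum_umvirate_liftCut_eq_zero (T₀ : Finset (Fin n)) {s e : ℕ} (hs : s ≤ e) (I J : Fin s → Fin n)
    {q : Finset (Fin n) → ℝ} (hq : SliceOrth T₀ e q) :
    ∑ π ∈ umvirate I J, q (cutOf T₀ π) = 0 := by
  classical
  set R : Finset (Fin n) := Finset.univ.image I with hR
  have hRcard : R.card ≤ e := (Finset.card_image_le.trans (by simp)).trans hs
  have hIR : ∀ k, I k ∈ R := fun k => Finset.mem_image.2 ⟨k, Finset.mem_univ _, rfl⟩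
  -- partition the umvirate by the value of the coupling
  have hpart : ∑ π ∈ umvirate I J, q (cutOf T₀ π) =
      ∑ U ∈ subslice T₀ I J, ((fibre T₀ I J U).card : ℝ) * q U := by
    rw [← Finset.sum_fiberwise_of_maps_to' (g := cutOf T₀) (fun π hπ => cutOf_mem_subslice hπ) q]
    refine Finset.sum_congr rfl fun U _ => ?_
    rw [Finset.sum_const, nsmul_eq_mul]
    rfl
  rw [hpart]
  rcases (subslice T₀ I J).eq_empty_or_nonempty with hS | ⟨U₀, hU₀⟩
  · rw [hS, Finset.sum_empty]
  · have hU₀' := mem_subslice.1 hU₀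
    -- traces on `R` are constant along the sub-slice, which is a full pattern class
    have htrace : ∀ U ∈ subslice T₀ I J, U ∩ R = U₀ ∩ R := by
      intro U hU
      have hU' := mem_subslice.1 hU
      ext x
      simp only [Finset.mem_inter]
      constructor
      · rintro ⟨hx, hxR⟩
        obtain ⟨k, -, rfl⟩ := Finset.mem_image.1 hxR
        exact ⟨(hU₀'.2 k).2 ((hU'.2 k).1 hx), hxR⟩
      · rintro ⟨hx, hxR⟩
        obtain ⟨k, -, rfl⟩ := Finset.mem_image.1 hxR
        exact ⟨(hU'.2 k).2 ((hU₀'.2 k).1 hx), hxR⟩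
    have hclass : subslice T₀ I J = (Finset.univ.powersetCard T₀.card).filter (fun U => U ∩ R = U₀ ∩ R) := by
      ext U
      rw [Finset.mem_filter, Finset.mem_powersetCard]
      constructor
      · intro hU
        exact ⟨⟨Finset.subset_univ _, (mem_subslice.1 hU).1⟩, htrace U hU⟩
      · rintro ⟨⟨-, hUc⟩, hUR⟩
        rw [mem_subslice]
        refine ⟨hUc, fun k => ?_⟩
        have h1 : I k ∈ U ↔ I k ∈ U₀ := by
          constructor
          · intro h; have : I k ∈ U ∩ R := Finset.mem_inter.2 ⟨h, hIR k⟩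
            rw [hUR] at this; exact (Finset.mem_inter.1 this).1
          · intro h; have : I k ∈ U₀ ∩ R := Finset.mem_inter.2 ⟨h, hIR k⟩
            rw [← hUR] at this; exact (Finset.mem_inter.1 this).1
        exact h1.trans (hU₀'.2 k)
    -- fibre counts are constant along the sub-slice
    have hconst : ∀ U ∈ subslice T₀ I J, ((fibre T₀ I J U).card : ℝ) = (fibre T₀ I J U₀).card := by
      intro U hU
      obtain ⟨σ, hσR, hσU⟩ := exists_perm_fix_map' R (hU₀'.1.trans (mem_subslice.1 hU).1.symm)
        ((htrace U hU).symm ▸ rfl)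
      rw [card_fibre_map (T₀ := T₀) (I := I) (J := J) (fun k => hσR _ (hIR k)) U₀, hσU]
    rw [Finset.sum_congr rfl fun U hU => by rw [hconst U hU], ← Finset.mul_sum, hclass,
      hq R hRcard (U₀ ∩ R), mul_zero]

/-- **`Mq ⊥ V_{≤ e}(S_n)` when `q` is orthogonal to the `e`-juntas of the slice.**
[cite: FilmusKindlerLifshitzMinzer2024, §7.4 Cor. 7.17] -/
theorem inner_vec_liftCut_eq_zero (T₀ : Finset (Fin n)) {e : ℕ} {q : Finset (Fin n) → ℝ} (hq : SliceOrth T₀ e q) :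
    ∀ w ∈ degLE n e, ⟪vec (liftCut T₀ q), w⟫_ℝ = 0 := by
  intro w hw
  induction hw using Submodule.span_induction with
  | mem x hx =>
    obtain ⟨s, hs, I, J, rfl⟩ := hx
    rw [real_inner_comm, inner_indVec_left]
    simp only [vec_apply, liftCut_apply]
    exact sum_umvirate_liftCut_eq_zero T₀ hs I J hq
  | zero => exact inner_zero_right _
  | add x y _ _ hx hy => rw [inner_add_right, hx, hy, add_zero]
  | smul a x _ hx => rw [inner_smul_right, hx, mul_zero]

/-! ## The level-`d` inequality on the slice -/

/-- **Level-`d` inequality for bounded `L¹`-global functions on a slice (dual form), at every slice size.**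
For `|h| ≤ G` on the `|T₀|`-subsets of `[n]`, `(r, γ, d)`-`L¹`-global on the slice, `r > 1`,
`0 < γ < G`, `1 ≤ d ≤ min(⅛ log(G/γ), 10⁻⁵ n)`, and a test function `q ∈ V_{≤ d}(slice)` orthogonal to the
`(d−1)`-juntas: `(Σ_U h(U) q(U))² ≤ C(n,t) · Σ_U q(U)² · γ² (5·10⁵ r² d⁻¹ log(G/γ))^d`
(`= ‖q‖₂² γ² (…)^d ⟨h,q⟩`-form in expectation normalisation). Method of Cor. 7.17 (lift by the coupling
`M`, which preserves norms, globalness and juntas) applied to the tree's proved Keevash–Lifshitz Thm. 3.1.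
[cite: FilmusKindlerLifshitzMinzer2024, §7.4 Cor. 7.17] [cite: KeevashLifshitz2023, Thm. 3.1 (p. 17)] -/
theorem slice_levelD_dual (T₀ : Finset (Fin n)) (h q : Finset (Fin n) → ℝ) {r γ G : ℝ} {d : ℕ}
    (hd : 1 ≤ d) (hr : 1 < r) (hγ : 0 < γ) (hγG : γ < G) (hhG : ∀ U, |h U| ≤ G)
    (hglob : IsL1GlobalSlice T₀ r γ d h)
    (hd₁ : (d : ℝ) ≤ Real.log (G / γ) / 8) (hd₂ : (d : ℝ) ≤ (n : ℝ) / 10 ^ 5)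
    (hq : q ∈ sliceDegLE n d) (hq' : SliceOrth T₀ (d - 1) q) :
    (∑ U ∈ Finset.univ.powersetCard T₀.card, h U * q U) ^ 2 ≤
      (n.choose T₀.card : ℝ) * (∑ U ∈ Finset.univ.powersetCard T₀.card, q U ^ 2) *
        (γ ^ 2 * (5 * 10 ^ 5 * r ^ 2 * (1 / (d : ℝ)) * Real.log (G / γ)) ^ d) := by
  set X : ℝ := γ ^ 2 * (5 * 10 ^ 5 * r ^ 2 * (1 / (d : ℝ)) * Real.log (G / γ)) ^ d with hX
  set A : ℝ := ∑ U ∈ Finset.univ.powersetCard T₀.card, h U * q U with hA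
  set B : ℝ := ∑ U ∈ Finset.univ.powersetCard T₀.card, q U ^ 2 with hB
  -- the `S_n` inequality for the lifts
  have hKL := isL1GlobalSn_dual (liftCut T₀ h) (vec (liftCut T₀ q)) hd hr hγ hγG (fun _ => hhG _)
    (isL1GlobalSn_liftCut hglob) hd₁ hd₂ (vec_liftCut_mem_degLE T₀ hq) (inner_vec_liftCut_eq_zero T₀ hq')
  -- transport the two sums back to the slice ("M preserves L_p norms")
  have e1 := choose_mul_sum_liftCut T₀ fun U => h U * q U
  have e2 := choose_mul_sum_liftCut T₀ fun U => q U ^ 2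
  set C : ℝ := ((n.choose T₀.card : ℕ) : ℝ) with hC
  set N : ℝ := ((Nat.factorial n : ℕ) : ℝ) with hN
  have hCpos : 0 < C := by
    rw [hC]; exact_mod_cast Nat.choose_pos (by simpa using T₀.card_le_univ)
  have hNpos : 0 < N := by rw [hN]; exact_mod_cast Nat.factorial_pos n
  have hS1 : ∑ σ, liftCut T₀ h σ * vec (liftCut T₀ q) σ = N * A / C := by
    rw [eq_div_iff hCpos.ne', mul_comm]
    simpa only [vec_apply, liftCut_apply] using e1
  have hS2 : ‖vec (liftCut T₀ q)‖ ^ 2 = N * B / C := by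
    rw [eq_div_iff hCpos.ne', mul_comm, norm_sq_eq_sum]
    simpa only [vec_apply, liftCut_apply] using e2
  rw [hS1, hS2] at hKL
  -- `(N A / C)² ≤ (N B / C) · N · X`  ⟹  `A² ≤ C · B · X`
  have h1 : (N * A / C) ^ 2 = N ^ 2 / C ^ 2 * A ^ 2 := by
    field_simp
  have h2 : N * B / C * (n.factorial : ℝ) * X = N ^ 2 / C ^ 2 * (C * B * X) := by
    rw [show (n.factorial : ℝ) = N from by rw [hN]]
    field_simp
  rw [h1, h2] at hKL
  have hpos : 0 < N ^ 2 / C ^ 2 := by positivity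
  have := le_of_mul_le_mul_left hKL hpos
  simpa only [hC] using this

end Literature.Combinatorics.Additive.KeevashLifshitz

end
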